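import Summits.ValiantsHypothesis.ValiantsHypothesis.Theorems.SymPencilPerFourBlocks

/-!
# Route `SymPencil` — two free rows: the Hessian form of `per_4` at `u = 𝟙` has no radical
# (the `per_4`-combinatorics of the rung `sdc(per_4) ≥ 21`, `--supports` stmt-ValiantsHypothesis-5674)

Let `V` be the `8`-dimensional space of `4 × 4` matrices with two prescribed zero rows (or two
prescribed zero columns) — by `SymPencilBoxFourEquality` this is every `8`-dimensional linear
subspace of `Sing Z(per_4)`.  Suppose that for EVERY matrix `u` the `s²`-coefficient `e₂ᵘ` of
`s ↦ per_4 (u + s x)` (`x ∈ V`) has a non-trivial radical inside `V`: a subspace `0 ≠ N ≤ V` with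
`e₂ᵘ (x₀ + x) = e₂ᵘ (x)` for `x₀ ∈ N`, `x ∈ V`.  This is absurd (`false_of_radical_family`): at
`u = 𝟙` on the two zero rows, `per_4 (u + s x) = 2 s² Σ_{j ≠ j'} x_{r j} x_{r' j'}` (`r, r'` the free
rows), the polarisation of which is the non-degenerate pairing `2 (J - I)` between the two free rows.

Canonical position (`false_of_radical_rows01`, zero rows `0, 1`) plus transport by row permutations
(`SymPencilPerFourBlocks.eval_perPoly_comp_prodCongr`) and transposition. [folklore]
-/

noncomputable section

-- single-conjunct layout: Sub = Summit, duplicated namespace component intended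
set_option linter.dupNamespace false

namespace Summit.ValiantsHypothesis.ValiantsHypothesis.Theorems.SymPencilPerFourTwoRowsRadical

open Matrix MvPolynomial Finset Module
open Literature.Computability.AlgebraicComplexity
open Summit.ValiantsHypothesis.ValiantsHypothesis.Theorems.SymPencilPerFourBlocks

variable {K : Type*} [Field K]

/-- The space of `4 × 4` matrices with rows `0, 1` zero has dimension `8`; hence an `8`-dimensional
subspace of it is all of it. [folklore] -/
theorem mem_of_rows01 (V : Submodule K (Fin 4 × Fin 4 → K)) (h8 : finrank K V = 8)
    (hV : ∀ x ∈ V, ∀ j, x (0, j) = 0 ∧ x (1, j) = 0) (x : Fin 4 × Fin 4 → K)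
    (h0 : ∀ j, x (0, j) = 0) (h1 : ∀ j, x (1, j) = 0) : x ∈ V := by
  let ρ : Fin 4 → (Fin 4 × Fin 4 → K) →ₗ[K] (Fin 4 → K) :=
    fun r => LinearMap.funLeft K K fun j => (r, j)
  have hρ : ∀ r x j, ρ r x j = x (r, j) := fun _ _ _ => rfl
  let U : Submodule K (Fin 4 × Fin 4 → K) := LinearMap.ker (ρ 0) ⊓ LinearMap.ker (ρ 1)
  have hVU : V ≤ U := fun y hy => by
    simp only [U, Submodule.mem_inf, LinearMap.mem_ker]
    exact ⟨funext fun j => (hV y hy j).1, funext fun j => (hV y hy j).2⟩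
  -- `dim U = 8` by rank–nullity twice
  have hlift : ∀ (r : Fin 4) (v : Fin 4 → K),
      ρ r (fun p : Fin 4 × Fin 4 => if p.1 = r then v p.2 else 0) = v := fun r v => by
    funext j; simp [hρ]
  have htop : (⊤ : Submodule K (Fin 4 × Fin 4 → K)).map (ρ 0) = ⊤ := by
    rw [eq_top_iff]
    rintro v -
    exact ⟨_, Submodule.mem_top, hlift 0 v⟩
  have hker0 : finrank K ↥(LinearMap.ker (ρ 0)) = 12 := by
    have h := AlperBogartVelasco.finrank_eq_finrank_map_add_finrank_inf_ker
      (⊤ : Submodule K (Fin 4 × Fin 4 → K)) (ρ 0)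
    rw [htop, finrank_top, finrank_top, top_inf_eq, finrank_fintype_fun_eq_card,
      finrank_fintype_fun_eq_card, Fintype.card_prod, Fintype.card_fin] at h
    omega
  have hmap1 : (LinearMap.ker (ρ 0)).map (ρ 1) = ⊤ := by
    rw [eq_top_iff]
    rintro v -
    refine ⟨fun p : Fin 4 × Fin 4 => if p.1 = 1 then v p.2 else 0, ?_, hlift 1 v⟩
    rw [SetLike.mem_coe, LinearMap.mem_ker]
    funext j
    simp [hρ]
  have hU : finrank K U = 8 := by
    have h := AlperBogartVelasco.finrank_eq_finrank_map_add_finrank_inf_ker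
      (LinearMap.ker (ρ 0)) (ρ 1)
    rw [hmap1, finrank_top, hker0, finrank_fintype_fun_eq_card, Fintype.card_fin] at h
    change 12 = 4 + finrank K U at h
    omega
  have hVeq : V = U := Submodule.eq_of_le_of_finrank_eq hVU (by rw [h8, hU])
  rw [hVeq]
  simp only [U, Submodule.mem_inf, LinearMap.mem_ker]
  exact ⟨funext h0, funext h1⟩

/-- **`per_4 (𝟙_{rows 0,1} + s x)` for `x` with rows `0, 1` zero**: `2 s²` times the pairing
`Σ_{j ≠ j'} x_{2j} x_{3j'}` of the two free rows. [folklore] -/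
theorem eval_perPoly_ones01_add_smul (x : Fin 4 × Fin 4 → K) (h0 : ∀ j, x (0, j) = 0)
    (h1 : ∀ j, x (1, j) = 0) (s : K) :
    eval ((fun p : Fin 4 × Fin 4 => if p.1 = 0 then (1 : K) else if p.1 = 1 then 1 else 0) + s • x)
        (perPoly (Fin 4) K) =
      s ^ 2 * (2 * ((x (2, 0) + x (2, 1) + x (2, 2) + x (2, 3)) *
          (x (3, 0) + x (3, 1) + x (3, 2) + x (3, 3)) -
        (x (2, 0) * x (3, 0) + x (2, 1) * x (3, 1) + x (2, 2) * x (3, 2) + x (2, 3) * x (3, 3)))) := by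
  rw [eval_perPoly, Matrix.permanent_fin_four_row]
  simp only [Matrix.of_apply, Pi.add_apply, Pi.smul_apply, smul_eq_mul, h0, h1,
    show ((2 : Fin 4) = 0) = False by decide, show ((2 : Fin 4) = 1) = False by decide,
    show ((3 : Fin 4) = 0) = False by decide, show ((3 : Fin 4) = 1) = False by decide,
    show ((1 : Fin 4) = 0) = False by decide, if_true, if_false, mul_zero, add_zero, zero_add]
  ring

/-- **Canonical position.**  `V` = matrices with rows `0, 1` zero (`dim V = 8`); if the
`s²`-coefficient of `per_4 (𝟙_{rows 0,1} + s x)` along `V` has a non-zero radical `N ≤ V`,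
contradiction. [folklore] -/
theorem false_of_radical_rows01 [CharZero K] (V N : Submodule K (Fin 4 × Fin 4 → K))
    (h8 : finrank K V = 8) (hV : ∀ x ∈ V, ∀ j, x (0, j) = 0 ∧ x (1, j) = 0) (hNV : N ≤ V)
    (hN : N ≠ ⊥) (e₂ : (Fin 4 × Fin 4 → K) → K)
    (he : ∀ x ∈ V, ∃ e₀ e₁ : K, ∀ s : K,
      eval ((fun p : Fin 4 × Fin 4 => if p.1 = 0 then (1 : K) else if p.1 = 1 then 1 else 0) + s • x)
        (perPoly (Fin 4) K) = e₀ + s * e₁ + s ^ 2 * e₂ x)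
    (hrad : ∀ x₀ ∈ N, ∀ x ∈ V, e₂ (x₀ + x) = e₂ x) : False := by
  -- the quadratic form
  let H : (Fin 4 × Fin 4 → K) → K := fun x =>
    2 * ((x (2, 0) + x (2, 1) + x (2, 2) + x (2, 3)) * (x (3, 0) + x (3, 1) + x (3, 2) + x (3, 3)) -
      (x (2, 0) * x (3, 0) + x (2, 1) * x (3, 1) + x (2, 2) * x (3, 2) + x (2, 3) * x (3, 3)))
  have hH : ∀ x, H x = 2 * ((x (2, 0) + x (2, 1) + x (2, 2) + x (2, 3)) *
      (x (3, 0) + x (3, 1) + x (3, 2) + x (3, 3)) -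
      (x (2, 0) * x (3, 0) + x (2, 1) * x (3, 1) + x (2, 2) * x (3, 2) + x (2, 3) * x (3, 3))) :=
    fun x => rfl
  -- `e₂ = H` on `V`
  have he₂ : ∀ x ∈ V, e₂ x = H x := by
    intro x hx
    obtain ⟨e₀, e₁, h⟩ := he x hx
    have P : ∀ s : K, e₀ + s * e₁ + s ^ 2 * e₂ x = s ^ 2 * H x := fun s => by
      rw [← h s, hH, eval_perPoly_ones01_add_smul x (fun j => (hV x hx j).1) (fun j => (hV x hx j).2)]
    have h0 := P 0
    have h1 := P 1
    have h1' := P (-1)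
    have h2 : (2 : K) * e₂ x = 2 * H x := by linear_combination h1 + h1' - 2 * h0
    exact (mul_right_inj' two_ne_zero).1 h2
  -- a non-zero element of the radical and the test vectors
  obtain ⟨x₀, hx₀N, hx₀⟩ := Submodule.exists_mem_ne_zero_of_ne_bot hN
  have hx₀V : x₀ ∈ V := hNV hx₀N
  have htest : ∀ y : Fin 4 × Fin 4 → K, (∀ j, y (0, j) = 0) → (∀ j, y (1, j) = 0) →
      H (x₀ + y) = H y := by
    intro y hy0 hy1
    have hyV : y ∈ V := mem_of_rows01 V h8 hV y hy0 hy1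
    rw [← he₂ y hyV, ← he₂ (x₀ + y) (V.add_mem hx₀V hyV)]
    exact hrad x₀ hx₀N y hyV
  have hz : H x₀ = 0 := by
    have h := htest 0 (fun _ => rfl) (fun _ => rfl)
    rw [add_zero] at h
    rw [h, hH]
    simp
  -- row `2` of `x₀` vanishes: test with `𝟙_{row 3}` and `E_{3c}`
  have t3 := htest (fun p => if p.1 = 3 then 1 else 0) (fun j => by simp) (fun j => by simp)
  have t30 := htest (Pi.single (3, 0) 1) (fun j => by simp) (fun j => by simp)
  have t31 := htest (Pi.single (3, 1) 1) (fun j => by simp) (fun j => by simp)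
  have t32 := htest (Pi.single (3, 2) 1) (fun j => by simp) (fun j => by simp)
  have t33 := htest (Pi.single (3, 3) 1) (fun j => by simp) (fun j => by simp)
  -- row `3` of `x₀` vanishes: test with `𝟙_{row 2}` and `E_{2c}`
  have t2 := htest (fun p => if p.1 = 2 then 1 else 0) (fun j => by simp) (fun j => by simp)
  have t20 := htest (Pi.single (2, 0) 1) (fun j => by simp) (fun j => by simp)
  have t21 := htest (Pi.single (2, 1) 1) (fun j => by simp) (fun j => by simp)
  have t22 := htest (Pi.single (2, 2) 1) (fun j => by simp) (fun j => by simp)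
  have t23 := htest (Pi.single (2, 3) 1) (fun j => by simp) (fun j => by simp)
  simp only [hH, Pi.add_apply, Pi.single_apply, Prod.mk.injEq,
    show ((2 : Fin 4) = 3) = False by decide, show ((3 : Fin 4) = 2) = False by decide,
    show ((0 : Fin 4) = 1) = False by decide, show ((0 : Fin 4) = 2) = False by decide,
    show ((0 : Fin 4) = 3) = False by decide, show ((1 : Fin 4) = 0) = False by decide,
    show ((1 : Fin 4) = 2) = False by decide, show ((1 : Fin 4) = 3) = False by decide,
    show ((2 : Fin 4) = 0) = False by decide, show ((2 : Fin 4) = 1) = False by decide,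
    show ((3 : Fin 4) = 0) = False by decide, show ((3 : Fin 4) = 1) = False by decide,
    and_true, and_false, if_true, if_false, add_zero, zero_add, mul_one,
    mul_zero, zero_mul] at t3 t30 t31 t32 t33 t2 t20 t21 t22 t23 hz
  set a0 := x₀ (2, 0); set a1 := x₀ (2, 1); set a2 := x₀ (2, 2); set a3 := x₀ (2, 3)
  set b0 := x₀ (3, 0); set b1 := x₀ (3, 1); set b2 := x₀ (3, 2); set b3 := x₀ (3, 3)
  have hSa : a0 + a1 + a2 + a3 = 0 := by
    have h6 : (6 : K) * (a0 + a1 + a2 + a3) = 0 := by linear_combination t3 - hz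
    exact (mul_eq_zero.1 h6).resolve_left (by norm_num)
  have hSb : b0 + b1 + b2 + b3 = 0 := by
    have h6 : (6 : K) * (b0 + b1 + b2 + b3) = 0 := by linear_combination t2 - hz
    exact (mul_eq_zero.1 h6).resolve_left (by norm_num)
  have ha0 : a0 = 0 := by
    have h : (2 : K) * a0 = 0 := by linear_combination hz - t30 + 2 * hSa
    exact (mul_eq_zero.1 h).resolve_left two_ne_zero
  have ha1 : a1 = 0 := by
    have h : (2 : K) * a1 = 0 := by linear_combination hz - t31 + 2 * hSa
    exact (mul_eq_zero.1 h).resolve_left two_ne_zero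
  have ha2 : a2 = 0 := by
    have h : (2 : K) * a2 = 0 := by linear_combination hz - t32 + 2 * hSa
    exact (mul_eq_zero.1 h).resolve_left two_ne_zero
  have ha3 : a3 = 0 := by
    have h : (2 : K) * a3 = 0 := by linear_combination hz - t33 + 2 * hSa
    exact (mul_eq_zero.1 h).resolve_left two_ne_zero
  have hb0 : b0 = 0 := by
    have h : (2 : K) * b0 = 0 := by linear_combination hz - t20 + 2 * hSb
    exact (mul_eq_zero.1 h).resolve_left two_ne_zero
  have hb1 : b1 = 0 := by
    have h : (2 : K) * b1 = 0 := by linear_combination hz - t21 + 2 * hSb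
    exact (mul_eq_zero.1 h).resolve_left two_ne_zero
  have hb2 : b2 = 0 := by
    have h : (2 : K) * b2 = 0 := by linear_combination hz - t22 + 2 * hSb
    exact (mul_eq_zero.1 h).resolve_left two_ne_zero
  have hb3 : b3 = 0 := by
    have h : (2 : K) * b3 = 0 := by linear_combination hz - t23 + 2 * hSb
    exact (mul_eq_zero.1 h).resolve_left two_ne_zero
  apply hx₀
  have hcases : ∀ i : Fin 4, i = 0 ∨ i = 1 ∨ i = 2 ∨ i = 3 := by decide
  funext ⟨i, j⟩
  rw [Pi.zero_apply]
  rcases hcases i with rfl | rfl | rfl | rfl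
  · exact (hV x₀ hx₀V j).1
  · exact (hV x₀ hx₀V j).2
  · rcases hcases j with rfl | rfl | rfl | rfl
    · exact ha0
    · exact ha1
    · exact ha2
    · exact ha3
  · rcases hcases j with rfl | rfl | rfl | rfl
    · exact hb0
    · exact hb1
    · exact hb2
    · exact hb3


/-- **Transport of a radical family along a `per_4`-preserving linear automorphism.**  If for
every `u` the `s²`-coefficient of `per_4 (u + s x)` along `V` has a non-zero radical, the same
holds for `Φ(V)` whenever `per_4 ∘ Φ = per_4`. [folklore] -/
theorem radical_family_map (V : Submodule K (Fin 4 × Fin 4 → K))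
    (Φ : (Fin 4 × Fin 4 → K) ≃ₗ[K] (Fin 4 × Fin 4 → K))
    (hΦ : ∀ z, eval (Φ z) (perPoly (Fin 4) K) = eval z (perPoly (Fin 4) K))
    (hform : ∀ u : Fin 4 × Fin 4 → K, ∃ N : Submodule K (Fin 4 × Fin 4 → K), N ≤ V ∧ N ≠ ⊥ ∧
      ∃ e₂ : (Fin 4 × Fin 4 → K) → K,
        (∀ x ∈ V, ∃ e₀ e₁ : K, ∀ s : K,
          eval (u + s • x) (perPoly (Fin 4) K) = e₀ + s * e₁ + s ^ 2 * e₂ x) ∧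
        (∀ x₀ ∈ N, ∀ x ∈ V, e₂ (x₀ + x) = e₂ x)) :
    ∀ u : Fin 4 × Fin 4 → K, ∃ N : Submodule K (Fin 4 × Fin 4 → K),
      N ≤ V.map Φ.toLinearMap ∧ N ≠ ⊥ ∧
      ∃ e₂ : (Fin 4 × Fin 4 → K) → K,
        (∀ y ∈ V.map Φ.toLinearMap, ∃ e₀ e₁ : K, ∀ s : K,
          eval (u + s • y) (perPoly (Fin 4) K) = e₀ + s * e₁ + s ^ 2 * e₂ y) ∧
        (∀ y₀ ∈ N, ∀ y ∈ V.map Φ.toLinearMap, e₂ (y₀ + y) = e₂ y) := by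
  intro u
  obtain ⟨N, hNV, hN, e₂, he, hrad⟩ := hform (Φ.symm u)
  refine ⟨N.map Φ.toLinearMap, Submodule.map_mono hNV, ?_, fun y => e₂ (Φ.symm y), ?_, ?_⟩
  · obtain ⟨x, hxN, hx⟩ := Submodule.exists_mem_ne_zero_of_ne_bot hN
    rw [Submodule.ne_bot_iff]
    exact ⟨Φ x, ⟨x, hxN, rfl⟩, fun h => hx (Φ.map_eq_zero_iff.1 h)⟩
  · rintro _ ⟨x, hx, rfl⟩
    obtain ⟨e₀, e₁, h⟩ := he x hx
    refine ⟨e₀, e₁, fun s => ?_⟩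
    have hu : u + s • Φ.toLinearMap x = Φ (Φ.symm u + s • x) := by
      rw [map_add, map_smul, LinearEquiv.apply_symm_apply]; rfl
    rw [hu, hΦ, h s]
    show _ = e₀ + s * e₁ + s ^ 2 * e₂ (Φ.symm (Φ x))
    rw [LinearEquiv.symm_apply_apply]
  · rintro _ ⟨x₀, hx₀, rfl⟩ _ ⟨x, hx, rfl⟩
    show e₂ (Φ.symm (Φ.toLinearMap x₀ + Φ.toLinearMap x)) = e₂ (Φ.symm (Φ.toLinearMap x))
    rw [LinearEquiv.coe_toLinearMap, ← map_add, LinearEquiv.symm_apply_apply,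
      LinearEquiv.symm_apply_apply]
    exact hrad x₀ hx₀ x hx

/-- `per_4` is invariant under transposition of the argument. [folklore] -/
theorem eval_perPoly_transpose (z : Fin 4 × Fin 4 → K) :
    eval (LinearEquiv.funCongrLeft K K (Equiv.prodComm (Fin 4) (Fin 4)) z) (perPoly (Fin 4) K) =
      eval z (perPoly (Fin 4) K) := by
  rw [eval_perPoly, eval_perPoly]
  have h : (Matrix.of fun i j =>
      LinearEquiv.funCongrLeft K K (Equiv.prodComm (Fin 4) (Fin 4)) z (i, j)) =
      (Matrix.of fun i j => z (i, j))ᵀ := by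
    ext i j; rfl
  rw [h, Matrix.permanent_transpose]

/-- **Two prescribed zero rows.**  The radical family is impossible on the `8`-dimensional space
of matrices with rows `a ≠ b` zero. [folklore] -/
theorem false_of_radical_family_rows [CharZero K] (V : Submodule K (Fin 4 × Fin 4 → K))
    (h8 : finrank K V = 8) {a b : Fin 4} (hab : a ≠ b)
    (hV : ∀ x ∈ V, ∀ j, x (a, j) = 0 ∧ x (b, j) = 0)
    (hform : ∀ u : Fin 4 × Fin 4 → K, ∃ N : Submodule K (Fin 4 × Fin 4 → K), N ≤ V ∧ N ≠ ⊥ ∧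
      ∃ e₂ : (Fin 4 × Fin 4 → K) → K,
        (∀ x ∈ V, ∃ e₀ e₁ : K, ∀ s : K,
          eval (u + s • x) (perPoly (Fin 4) K) = e₀ + s * e₁ + s ^ 2 * e₂ x) ∧
        (∀ x₀ ∈ N, ∀ x ∈ V, e₂ (x₀ + x) = e₂ x)) : False := by
  obtain ⟨σ, hσ0, hσ1⟩ := exists_perm_zero_one a b hab
  set e := Equiv.prodCongr σ (1 : Equiv.Perm (Fin 4)) with he
  set Φ : (Fin 4 × Fin 4 → K) ≃ₗ[K] (Fin 4 × Fin 4 → K) := LinearEquiv.funCongrLeft K K e with hΦ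
  have hΦa : ∀ (x : Fin 4 × Fin 4 → K) (i j : Fin 4), Φ x (i, j) = x (σ i, j) := fun x i j => by
    simp [hΦ, he]
  have hΦper : ∀ z, eval (Φ z) (perPoly (Fin 4) K) = eval z (perPoly (Fin 4) K) := fun z => by
    have : (Φ z : Fin 4 × Fin 4 → K) = z ∘ e := rfl
    rw [this, he, eval_perPoly_comp_prodCongr]
  have hform' := radical_family_map V Φ hΦper hform
  set V' := V.map Φ.toLinearMap with hV'def
  have h8' : finrank K V' = 8 := by rw [hV'def, LinearEquiv.finrank_map_eq, h8]
  have hV' : ∀ y ∈ V', ∀ j, y (0, j) = 0 ∧ y (1, j) = 0 := by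
    rintro _ ⟨x, hx, rfl⟩ j
    rw [LinearEquiv.coe_toLinearMap, hΦa, hΦa, hσ0, hσ1]
    exact hV x hx j
  obtain ⟨N, hNV, hN, e₂, he₂, hrad⟩ :=
    hform' (fun p : Fin 4 × Fin 4 => if p.1 = 0 then (1 : K) else if p.1 = 1 then 1 else 0)
  exact false_of_radical_rows01 V' N h8' hV' hNV hN e₂ he₂ hrad

/-- **Two prescribed zero rows or two prescribed zero columns** (the two cases of
`SymPencilBoxFourEquality.two_rows_or_two_cols`): the radical family is impossible. [folklore] -/
theorem false_of_radical_family [CharZero K] (V : Submodule K (Fin 4 × Fin 4 → K))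
    (h8 : finrank K V = 8)
    (hV : (∃ a b : Fin 4, a ≠ b ∧ ∀ x ∈ V, ∀ j, x (a, j) = 0 ∧ x (b, j) = 0) ∨
      (∃ a b : Fin 4, a ≠ b ∧ ∀ x ∈ V, ∀ i, x (i, a) = 0 ∧ x (i, b) = 0))
    (hform : ∀ u : Fin 4 × Fin 4 → K, ∃ N : Submodule K (Fin 4 × Fin 4 → K), N ≤ V ∧ N ≠ ⊥ ∧
      ∃ e₂ : (Fin 4 × Fin 4 → K) → K,
        (∀ x ∈ V, ∃ e₀ e₁ : K, ∀ s : K,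
          eval (u + s • x) (perPoly (Fin 4) K) = e₀ + s * e₁ + s ^ 2 * e₂ x) ∧
        (∀ x₀ ∈ N, ∀ x ∈ V, e₂ (x₀ + x) = e₂ x)) : False := by
  rcases hV with ⟨a, b, hab, hV⟩ | ⟨a, b, hab, hV⟩
  · exact false_of_radical_family_rows V h8 hab hV hform
  · -- transpose, then the row case
    set Φ : (Fin 4 × Fin 4 → K) ≃ₗ[K] (Fin 4 × Fin 4 → K) :=
      LinearEquiv.funCongrLeft K K (Equiv.prodComm (Fin 4) (Fin 4)) with hΦ
    have hΦa : ∀ (x : Fin 4 × Fin 4 → K) (i j : Fin 4), Φ x (i, j) = x (j, i) := fun x i j => rfl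
    have hform' := radical_family_map V Φ eval_perPoly_transpose hform
    set V' := V.map Φ.toLinearMap with hV'def
    have h8' : finrank K V' = 8 := by rw [hV'def, LinearEquiv.finrank_map_eq, h8]
    have hV' : ∀ y ∈ V', ∀ j, y (a, j) = 0 ∧ y (b, j) = 0 := by
      rintro _ ⟨x, hx, rfl⟩ j
      rw [LinearEquiv.coe_toLinearMap, hΦa, hΦa]
      exact hV x hx j
    exact false_of_radical_family_rows V' h8' hab hV' hform'

end Summit.ValiantsHypothesis.ValiantsHypothesis.Theorems.SymPencilPerFourTwoRowsRadical

end
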